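import Mathlib
import Summits.CriticalPhenomena.CardyFormulaZ2.Theses.CardyTotalPositivity

/-!
# Birth skeleton (BC3) for the piece `HalfPlaneKernelTN` (stmt-CriticalPhenomena-11300)

of the glued split `AsymptoticKernelTN ⇐ HalfPlaneKernelTN ∧ FirstHitDecomposition`
(strategist cstrat-stmt-CriticalPhenomena-11297). Line "tall boxes": two registered stubs and the
kernel-checked composition `HalfPlaneKernelTN_of`; sorries ONLY inside `stub_*`.

* `stub_tallBoxTN` — for every order `r` and every strictly increasing index tuple `(s, x)`,
  `x ≥ 1`, the point first-hit minors of the BOX kernel `k_L(s,x)` (first hit of the arc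
  `A_s ∩ [-L, L]` inside the box `[-L, L] × [0, L]`) are `≥ 0` for all large `L` (each instance is
  a finite, exactly computable inequality — the refuters' transfer matrices; consistent with the
  extent table of stmt-CriticalPhenomena-9322: the box violations sit at order ≈ height + 1 and
  disappear as the box grows).
* `stub_boxExhaustion` — box exhaustion: `k_L(s,x) → k(s,x)` as `L → ∞` (both crossing events of
  the difference increase to their half-plane versions; continuity of the measure from below).
* `HalfPlaneKernelTN_of` — the determinant is continuous, so the half-plane minor is the limit of
  the box minors, and a limit of eventually nonnegative reals is nonnegative (`ge_of_tendsto`).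
-/

namespace Summit.CriticalPhenomena.CardyFormulaZ2.Cruxes.AsymptoticKernelTN.HalfPlaneKernelTNBirth

open MeasureTheory Set Filter Topology
open Literature.Probability.Percolation Literature.Probability.LatticeModels
open Summit.CriticalPhenomena.CardyFormulaZ2.Theses.CardyTotalPositivity

/-- the critical bond measure on `ℤ²` -/
noncomputable abbrev μ : Measure (BondConfig (Site 2)) := bondPercolation (zdGraph 2) half

/-- the lattice upper half-plane -/
def H : Set (Site 2) := {v : Site 2 | 0 ≤ v 1}

/-- the lattice box `[-L, L] × [0, L]` -/
def box (L : ℕ) : Set (Site 2) := {v : Site 2 | 0 ≤ v 1 ∧ v 1 ≤ (L : ℤ) ∧ -(L : ℤ) ≤ v 0 ∧ v 0 ≤ (L : ℤ)}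

/-- the wired arc `A_s = {(i,0) : i ≤ -s}` -/
def arc (s : ℕ) : Set (Site 2) := {v | v 1 = 0 ∧ v 0 ≤ -(s : ℤ)}

/-- the first-hit event `{X^{(s)} = x}` for paths restricted to the domain `D` -/
def hitIn (D : Set (Site 2)) (s x : ℕ) : Set (BondConfig (Site 2)) :=
  openCrossing D (arc s) {![(x : ℤ), 0]} \ openCrossing D (arc s) {v | v 1 = 0 ∧ 1 ≤ v 0 ∧ v 0 < x}

/-- the point first-hit kernel in the domain `D` -/
noncomputable def kIn (D : Set (Site 2)) (s x : ℕ) : ℝ := μ.real (hitIn D s x)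

/-- the piece, unfolded over the clean names (definitional) -/
theorem halfPlaneKernelTN_iff :
    HalfPlaneKernelTN ↔ ∀ (r : ℕ) (s x : Fin r → ℕ), StrictMono s → StrictMono x →
      (∀ j, 1 ≤ x j) → 0 ≤ (Matrix.of fun i j ↦ kIn H (s i) (x j)).det :=
  Iff.rfl

/-- stub 1: TALL-BOX total nonnegativity — eventually in the box size `L`, every point minor of the
box first-hit kernel on a strictly increasing index tuple is `≥ 0`. -/
theorem stub_tallBoxTN : ∀ (r : ℕ) (s x : Fin r → ℕ), StrictMono s → StrictMono x →
    (∀ j, 1 ≤ x j) → ∀ᶠ L : ℕ in atTop, 0 ≤ (Matrix.of fun i j ↦ kIn (box L) (s i) (x j)).det := by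
  sorry

/-- stub 2: box exhaustion of the point first-hit kernel. -/
theorem stub_boxExhaustion : ∀ s x : ℕ,
    Tendsto (fun L : ℕ ↦ kIn (box L) s x) atTop (𝓝 (kIn H s x)) := by
  sorry

/-- composition: the two stubs give the piece. -/
theorem HalfPlaneKernelTN_of
    (h1 : ∀ (r : ℕ) (s x : Fin r → ℕ), StrictMono s → StrictMono x → (∀ j, 1 ≤ x j) →
      ∀ᶠ L : ℕ in atTop, 0 ≤ (Matrix.of fun i j ↦ kIn (box L) (s i) (x j)).det)
    (h2 : ∀ s x : ℕ, Tendsto (fun L : ℕ ↦ kIn (box L) s x) atTop (𝓝 (kIn H s x))) :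
    HalfPlaneKernelTN := by
  rw [halfPlaneKernelTN_iff]
  intro r s x hs hx hx1
  have hM : Tendsto (fun L : ℕ ↦ (Matrix.of fun i j ↦ kIn (box L) (s i) (x j)))
      atTop (𝓝 (Matrix.of fun i j ↦ kIn H (s i) (x j))) := by
    refine tendsto_pi_nhds.mpr fun i ↦ tendsto_pi_nhds.mpr fun j ↦ ?_
    simpa using h2 (s i) (x j)
  have hdet : Tendsto (fun L : ℕ ↦ (Matrix.of fun i j ↦ kIn (box L) (s i) (x j)).det)
      atTop (𝓝 ((Matrix.of fun i j ↦ kIn H (s i) (x j)).det)) :=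
    ((continuous_id.matrix_det).tendsto _).comp hM
  exact ge_of_tendsto hdet (h1 r s x hs hx hx1)

end Summit.CriticalPhenomena.CardyFormulaZ2.Cruxes.AsymptoticKernelTN.HalfPlaneKernelTNBirth
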